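import Summits.ResolutionOfSingularities.ResolutionOfSingularities.Theorems.FrobeniusClosingPatchingRelPerfectCuspDepthFourMemberCharts
import Summits.ResolutionOfSingularities.ResolutionOfSingularities.Theorems.FrobeniusClosingPatchingRelPerfectCuspDepthFourPersistenceWeak
import Summits.ResolutionOfSingularities.ResolutionOfSingularities.Theorems.FrobeniusClosingPatchingRelPerfectChartStrictExceptional
import Literature.AlgebraicGeometry.Resolution.RsopMonomialIdeals
import Literature.AlgebraicGeometry.Resolution.BoundaryRestriction
import HarnessLib

/-!
# Crux `PatchingRelPerfect` (stmt-ResolutionOfSingularities-16161), chain w52 — kernel certificate of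
# the NON-GRADED DEPTH-FOUR member `(x₃² + x₀³) + 𝔪⁶`, part 3b: the member over a regular local ring

[OURS · L1 W5.2 · kernel (iii) beyond F6 (ℓ ≥ 3 non-graded, F6 memo §6 «not designed»), CHAIN v2.0
§1 (C)] Assembly of parts 1–3a (p528899, p529907, p530733, p532963, p535249 and its weak sibling,
p534431; tangent Euclid p527008; tools p531731) with stub-4's chartwise assembly
`isRegular_of_isBlowup_mul_of_charts` (Stacks 080A), exactly as the cusp member `(x₃² + x₀³) + 𝔪⁴`
(`CuspMember.companion_member`, p518846): for `S` regular local (ANY dimension, characteristic,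
residue field), a regular system of parameters written `(z, v₁, …, v_m)` and `w = v_{kw}`,

* `CuspDepthFour.companion_member₆`, `coreRung_member₆`, `atomDimFourBlowupAt_member₆` —
  `I = (z² + w³) + 𝔪⁶ ∈ 𝒞`: the blowing up of `Spec S` along `(I · Q₀) · 𝔪` is regular, where
  `Q₀ = 𝔞_{Π₂} · 𝔞_{Σ̃} · ∏_{k<6} 𝔅_{k+2} · 𝔞_{L₁} ⊇ 𝔪¹⁰⁵` (note `NONGRADED-DEPTH4-MEMBER.md` §3,
  evidence #59; chart table kit j276688): on the chart of `z` everything is Cartier, on the chart of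
  `w` it is `CoreRungTower.tangent_euclid_two 3`, on every other chart it is the ring-level tower
  theorem `CuspDepthFour.depthFour_isRegular'` — 11 regular centres: `𝔪`; the line `L₁`; the
  SURFACE `Π₂ = E₂ ∩ D̃_z` (closing the `(4,2)` monomial escape); `Σ̃`; Euclid `(1,7)`.

The first kernel certificate of a NON-GRADED member of exceptional depth FOUR.  FORMAT evidence for
the core on the `𝔪`-primary stratum, nothing about standing; nothing here is a statement of the
manuscript under review.

## References

* The Stacks Project, Tags 080A, 0804, 0BIQ. [StacksProject]
* Q. Liu, *Algebraic Geometry and Arithmetic Curves*, OUP 2002, Thm. 8.1.19 (a). [Liu2002]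
* U. Görtz, T. Wedhorn, *Algebraic Geometry I*, 2nd ed. 2020, Prop. 13.91 (2), 13.96 (2). [GortzWedhorn2020]
-/

-- `Summit.<Summit>.<Sub>.Theorems` with `Sub = Summit` (single-conjunct summit, D-0017)
set_option linter.dupNamespace false

noncomputable section

open CategoryTheory CategoryTheory.Limits AlgebraicGeometry Literature.AlgebraicGeometry.Resolution
open scoped Pointwise nonZeroDivisors

namespace Summit.ResolutionOfSingularities.ResolutionOfSingularities.Theorems

universe u

namespace CuspDepthFour

/-! ## Notation (as in parts 1–3a) -/

local notation3 "Pf[" t "," c "," a "]" => (Ideal.span {a ^ 2} ⊔ Ideal.span {c} ⊔ Ideal.span {t ^ 2})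
local notation3 "Sf[" t "," c "," a "]" => (Ideal.span {c} ⊔ Ideal.span {t * a} ⊔ Ideal.span {t ^ 2})
local notation3 "Kf[" t "," c "," a "]" => (Ideal.span {c ^ 2 + t * a ^ 3} ⊔ Ideal.span {t ^ 4})
local notation3 "Bf[" t "," c "," a "," k "]" =>
  (Ideal.span {a ^ (2 * k) * (c ^ 2 + t * a ^ 3)} ⊔ Ideal.span {c ^ (k + 2)} ⊔ Ideal.span {t ^ (2 * k + 4)})
local notation3 "Ff[" t "," c "," a "]" =>
  (Pf[t,c,a] * Sf[t,c,a] * Kf[t,c,a] * ∏ k ∈ Finset.range 6, Bf[t,c,a,k])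
local notation3 "FS[" t "," c "," a "]" => (Ff[t,c,a] * Ideal.span (Set.range ![t, c, a]))
/-- The tangent-Euclid product of `CoreRungTower.tangent_euclid_two 3` (`η = 1`). -/
local notation3 "TE[" t "," c "]" =>
  (((Ideal.span {1 * t + c ^ 2} ⊔ Ideal.span {t ^ (3 + 1)}) *
    ∏ k ∈ Finset.range (2 * 3), (Ideal.span {1 * t + c ^ 2} ⊔ Ideal.span {c ^ (k + 2)})) *
    Ideal.span (Set.range ![t, c]))

/-- `FS_a_one` with the unit letter abstracted (robust rewriting on the chart of `w`). [folklore] -/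
theorem FS_a_eq_one {A : Type u} [CommRing A] (t c a : A) (ha : a = 1) : FS[t, c, a] = TE[t, c] := by
  subst ha
  exact FS_a_one t c

section LocalRung

variable {S : Type u} [CommRing S] [IsRegularLocalRing S] {m : ℕ} (z : S) (v : Fin m → S)
  (hx : Ideal.span (Set.range (Fin.cons z v : Fin (m + 1) → S)) = IsLocalRing.maximalIdeal S)
  (hd : (IsLocalRing.maximalIdeal S).spanFinrank = m + 1) (kw : Fin m)

/-- The regular system of parameters `(z, v₁, …, v_m)`. -/
local notation3 "xs" => (Fin.cons z v : Fin (m + 1) → S)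
/-- `M = 𝔪`. -/
local notation3 "M" => Ideal.span (Set.range (Fin.cons z v : Fin (m + 1) → S))
/-- The member `I = (z² + w³) + 𝔪⁶`, `w = v_{kw}`. -/
local notation3 "II" => (Ideal.span {xs 0 ^ 2 + xs (Fin.succ kw) ^ 3} ⊔
  Ideal.span (Set.range (Fin.cons z v : Fin (m + 1) → S)) ^ 6)
/-- The member written with `𝔪` itself (the statements below use this form). -/
local notation3 "II𝔪" => (Ideal.span {xs 0 ^ 2 + xs (Fin.succ kw) ^ 3} ⊔ IsLocalRing.maximalIdeal S ^ 6)
local notation3 "aL" => (Ideal.span {xs (Fin.succ kw)} ⊔ Ideal.span {xs 0} ⊔ M ^ 2)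
local notation3 "aP" => (Ideal.span {xs (Fin.succ kw) ^ 2} ⊔ Ideal.span {xs 0} * M ⊔ M ^ 4)
local notation3 "aS" => (Ideal.span {xs 0} ⊔ Ideal.span {xs (Fin.succ kw)} * M ⊔ M ^ 3)
local notation3 "aB[" k "]" => (Ideal.span {xs (Fin.succ kw) ^ (2 * k) * (xs 0 ^ 2 + xs (Fin.succ kw) ^ 3)} ⊔
  Ideal.span {xs 0 ^ (k + 2)} * M ^ k ⊔ M ^ (4 * k + 6))
/-- The companion `Q₀`. -/
local notation3 "Q₀" => (aP * aS * (∏ k ∈ Finset.range 6, aB[k]) * aL)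

include hx hd in
/-- `v_k ∉ (z)`: distinct members of a regular system of parameters do not divide each other.
[cite: Matsumura1987, Thm. 14.2] -/
theorem v_notMem_span_z (k : Fin m) : v k ∉ Ideal.span {z} := by
  have hz : IsRsopPart (xs ∘ id) := isRsopPart_comp_of_rsop hd xs hx id Function.injective_id
  intro h
  have h' : xs 0 ∣ xs (Fin.succ k) := by
    have e0 : xs 0 = z := rfl
    have e1 : xs (Fin.succ k) = v k := by simp
    rw [e0, e1]; exact Ideal.mem_span_singleton.mp h
  exact hz.not_dvd (Fin.succ_ne_zero k).symm h'

include hx hd in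
set_option maxHeartbeats 400000 in
/-- **Every Rees chart of `Bl_𝔪 Spec S` blown up along `(I Q₀) · B_i` is regular** (chart of `z`:
Cartier; chart of `w`: `tangent_euclid_two 3`; other charts: `depthFour_isRegular'`).
[cite: Liu2002, Thm. 8.1.19 (a)] [cite: StacksProject, Tag 080A] [cite: StacksProject, Tag 0BIQ] -/
theorem isRegular_charts₆ (i : Fin (m + 1)) (Y : Scheme.{u}) (ρ : Y ⟶ Spec (.of (chartRing xs i)))
    (hρ : IsBlowup ρ (affineBlowup.idealSheaf ((II * Q₀).map (chartBase xs i)))) :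
    Scheme.IsRegular Y := by
  haveI : IsRegularRing S := isRegularRing_of_isRegularLocalRing S
  haveI : IsDomain S := isDomain_of_isRegularLocalRing S
  haveI hmax : (Ideal.span (Set.range xs)).IsMaximal := hx ▸ IsLocalRing.maximalIdeal.isMaximal S
  letI := Ideal.Quotient.field (Ideal.span (Set.range xs))
  haveI : IsRegularRing (S ⧸ Ideal.span (Set.range xs)) := inferInstance
  have hq : IsQuasiRegular xs := isQuasiRegular_regularSystemOfParameters hd xs hx
  have hz : IsRsopPart (xs ∘ id) := isRsopPart_comp_of_rsop hd xs hx id Function.injective_id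
  have hne : ∀ j, xs j ≠ 0 := fun j => hz.ne_zero j
  haveI hB : IsRegularRing (chartRing xs i) := isRegularRing_blowupChart xs i hq
  haveI hBD : IsDomain (chartRing xs i) := isDomain_chartRing xs i (hne i)
  have hu : chartBase xs i (xs i) ∈ (chartRing xs i)⁰ :=
    reesChartBase_mem_nonZeroDivisors (xs i) (Ideal.mem_span_range_self (f := xs) (x := i))
  have he : chartGen xs i i = 1 :=
    CuspMember.eq_one_of_eq_mul_self hu (reesChartBase_apply_eq_mul_chartGen xs i i)
  rw [map_member₆_mul_Q₀] at hρ
  refine CoreRungTower.isRegular_of_isBlowup_span_singleton_mul (pow_mem hu 48) _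
    (fun Y' ρ' hρ' => ?_) hρ
  by_cases hi0 : i = 0
  · -- chart of `z`: `c = 1`, everything Cartier
    subst hi0
    rw [he, FS_c_one, affineBlowup.idealSheaf_top] at hρ'
    haveI : IsIso ρ' := hρ'.isIso isEffectiveCartier_top
    haveI : IsRegularRing (CommRingCat.of (chartRing xs 0)) := hB
    exact SectionAscent.TraceIdeal.isRegular_of_iso (asIso ρ') (Scheme.isRegular_Spec _)
  obtain ⟨k, rfl⟩ := Fin.exists_succ_eq.mpr hi0
  have h0k : (0 : Fin (m + 1)) ≠ Fin.succ k := (Fin.succ_ne_zero k).symm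
  by_cases hkw : k = kw
  · -- chart of `w`: `a = 1`, tangent Euclid `(2, 4)` for `(u, c)`
    subst hkw
    rw [FS_a_eq_one (chartBase xs (Fin.succ k) (xs (Fin.succ k))) (chartGen xs (Fin.succ k) 0)
      (chartGen xs (Fin.succ k) (Fin.succ k)) (by rw [he])] at hρ'
    let jJ : Fin 1 → {j : Fin (m + 1) // j ≠ Fin.succ k} := fun _ => ⟨0, h0k⟩
    have hfun : (Fin.cons (chartBase xs (Fin.succ k) (xs (Fin.succ k))) fun l => chartGen xs (Fin.succ k) (jJ l).1 :
        Fin 2 → chartRing xs (Fin.succ k)) = ![chartBase xs (Fin.succ k) (xs (Fin.succ k)), chartGen xs (Fin.succ k) 0] := by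
      funext l; fin_cases l <;> rfl
    have hq2 : IsQuasiRegular (![chartBase xs (Fin.succ k) (xs (Fin.succ k)), chartGen xs (Fin.succ k) 0] :
        Fin 2 → chartRing xs (Fin.succ k)) := by
      rw [← hfun]
      exact CoreRungTower.isQuasiRegular_chartFamily xs (Fin.succ k) jJ hq (fun a b _ => Subsingleton.elim a b)
    have hR2 : IsRegularRing (chartRing xs (Fin.succ k) ⧸ Ideal.span (Set.range
        (![chartBase xs (Fin.succ k) (xs (Fin.succ k)), chartGen xs (Fin.succ k) 0] :
          Fin 2 → chartRing xs (Fin.succ k)))) := by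
      rw [← hfun]
      exact CoreRungTower.isRegularRing_quot_chartFamily xs (Fin.succ k) jJ hq
    exact CoreRungTower.tangent_euclid_two 3 _ _ 1 isUnit_one hq2 hR2 hρ'
  · -- a `y`-chart: the ring-level tower for `(u, c, a) = (v_k/1, z/v_k, w/v_k)`
    have hkw' : Fin.succ kw ≠ Fin.succ k := fun h => hkw (Fin.succ_injective _ h).symm
    have h0kw : (0 : Fin (m + 1)) ≠ Fin.succ kw := (Fin.succ_ne_zero kw).symm
    let jJ : Fin 2 → {j : Fin (m + 1) // j ≠ Fin.succ k} := ![⟨0, h0k⟩, ⟨Fin.succ kw, hkw'⟩]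
    have hjJ : Function.Injective jJ := by
      intro a b hab
      fin_cases a <;> fin_cases b
      · rfl
      · exact absurd (congrArg Subtype.val hab) h0kw
      · exact absurd (congrArg Subtype.val hab) (Ne.symm h0kw)
      · rfl
    have hfun : (fun l : Fin 2 => chartGen xs (Fin.succ k) (jJ l).1) =
        ![chartGen xs (Fin.succ k) 0, chartGen xs (Fin.succ k) (Fin.succ kw)] := by
      funext l; fin_cases l <;> rfl
    have hw3 : RingTheory.Sequence.IsWeaklyRegular (chartRing xs (Fin.succ k))
        [chartBase xs (Fin.succ k) (xs (Fin.succ k)), chartGen xs (Fin.succ k) 0,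
          chartGen xs (Fin.succ k) (Fin.succ kw)] := by
      have h := CoreRungTower.isWeaklyRegular_chartFamily xs (Fin.succ k) jJ hq hjJ
      have hl : List.ofFn (Fin.cons (chartBase xs (Fin.succ k) (xs (Fin.succ k))) fun l => chartGen xs (Fin.succ k) (jJ l).1) =
          [chartBase xs (Fin.succ k) (xs (Fin.succ k)), chartGen xs (Fin.succ k) 0,
            chartGen xs (Fin.succ k) (Fin.succ kw)] := rfl
      rw [hl] at h
      exact h
    have h3 : IsRegularRing (chartRing xs (Fin.succ k) ⧸ (Ideal.span {chartBase xs (Fin.succ k) (xs (Fin.succ k))} ⊔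
        Ideal.span {chartGen xs (Fin.succ k) 0} ⊔ Ideal.span {chartGen xs (Fin.succ k) (Fin.succ kw)})) := by
      have h := CoreRungTower.isRegularRing_quot_chartFamily xs (Fin.succ k) jJ hq
      have hI : Ideal.span (Set.range (Fin.cons (chartBase xs (Fin.succ k) (xs (Fin.succ k)))
          fun l => chartGen xs (Fin.succ k) (jJ l).1 : Fin 3 → chartRing xs (Fin.succ k))) =
          Ideal.span {chartBase xs (Fin.succ k) (xs (Fin.succ k))} ⊔ Ideal.span {chartGen xs (Fin.succ k) 0} ⊔
            Ideal.span {chartGen xs (Fin.succ k) (Fin.succ kw)} := by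
        rw [Fin.range_cons (chartBase xs (Fin.succ k) (xs (Fin.succ k)))
          (fun l => chartGen xs (Fin.succ k) (jJ l).1), hfun, Ideal.span_insert,
          CuspMember.span_range_vec2 (chartGen xs (Fin.succ k) 0) (chartGen xs (Fin.succ k) (Fin.succ kw)),
          ← sup_assoc]
      rw [hI] at h
      exact h
    have h2 : IsRegularRing (chartRing xs (Fin.succ k) ⧸ (Ideal.span {chartBase xs (Fin.succ k) (xs (Fin.succ k))} ⊔
        Ideal.span {chartGen xs (Fin.succ k) 0})) := by
      let jJ' : Fin 1 → {j : Fin (m + 1) // j ≠ Fin.succ k} := fun _ => ⟨0, h0k⟩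
      have h := CoreRungTower.isRegularRing_quot_chartFamily xs (Fin.succ k) jJ' hq
      have hr : (fun l : Fin 1 => chartGen xs (Fin.succ k) (jJ' l).1) = fun _ => chartGen xs (Fin.succ k) 0 :=
        funext fun _ => rfl
      have hI : Ideal.span (Set.range (Fin.cons (chartBase xs (Fin.succ k) (xs (Fin.succ k)))
          fun l => chartGen xs (Fin.succ k) (jJ' l).1 : Fin 2 → chartRing xs (Fin.succ k))) =
          Ideal.span {chartBase xs (Fin.succ k) (xs (Fin.succ k))} ⊔ Ideal.span {chartGen xs (Fin.succ k) 0} := by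
        rw [Fin.range_cons (chartBase xs (Fin.succ k) (xs (Fin.succ k)))
          (fun l => chartGen xs (Fin.succ k) (jJ' l).1), hr, Set.range_const, Ideal.span_insert]
      rw [hI] at h
      exact h
    -- the strict transform of `V(z)`: `B/(c)` is a domain in which `u`, `a` are non-zero
    haveI : IsDomain (S ⧸ Ideal.span {z}) := by
      haveI h1 := isRegularLocalRing_quotient_span_image hd xs hx {0}
      have e : (xs '' (({0} : Finset (Fin (m + 1))) : Set (Fin (m + 1)))) = {z} := by
        rw [Finset.coe_singleton, Set.image_singleton]; rfl
      rw [e] at h1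
      exact isDomain_of_isRegularLocalRing _
    have hvk : v k ∉ Ideal.span {z} := v_notMem_span_z z v hx hd k
    haveI hcD : IsDomain (chartRing xs (Fin.succ k) ⧸ Ideal.span {chartGen xs (Fin.succ k) 0}) :=
      ConeRung.strictExc_isDomain_quot z v k hq hvk
    have hc0 : chartGen xs (Fin.succ k) 0 ≠ 0 := by
      intro h0
      have hzz : chartBase xs (Fin.succ k) (xs 0) ∈ (chartRing xs (Fin.succ k))⁰ :=
        reesChartBase_mem_nonZeroDivisors_of_mem_nonZeroDivisors (I := Ideal.span (Set.range xs)) (xs (Fin.succ k))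
          (Ideal.mem_span_range_self (f := xs) (x := Fin.succ k)) (mem_nonZeroDivisors_of_ne_zero (hne 0))
      have cb : chartBase xs (Fin.succ k) (xs 0) = chartBase xs (Fin.succ k) (xs (Fin.succ k)) * chartGen xs (Fin.succ k) 0 :=
        reesChartBase_apply_eq_mul_chartGen xs (Fin.succ k) 0
      exact nonZeroDivisors.ne_zero hzz (by rw [cb, h0]; exact mul_zero (chartBase xs (Fin.succ k) (xs (Fin.succ k))))
    have e0 : chartBase xs (Fin.succ k) (v k) =
        chartBase xs (Fin.succ k) (xs (Fin.succ k)) ^ 0 * chartBase xs (Fin.succ k) (xs (Fin.succ k)) := by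
      simp
    have huc : chartBase xs (Fin.succ k) (xs (Fin.succ k)) ∉ Ideal.span {chartGen xs (Fin.succ k) 0} :=
      ConeRung.strictExc_notMem_of_chartBase_eq z v k hq hvk e0 hvk
    have e1 : chartBase xs (Fin.succ k) (v kw) =
        chartBase xs (Fin.succ k) (xs (Fin.succ k)) ^ 1 * chartGen xs (Fin.succ k) (Fin.succ kw) := by
      rw [show chartBase xs (Fin.succ k) (xs (Fin.succ k)) ^ 1 = chartBase xs (Fin.succ k) (xs (Fin.succ k))
        from pow_one _]
      exact reesChartBase_apply_eq_mul_chartGen xs (Fin.succ k) (Fin.succ kw)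
    have hac : chartGen xs (Fin.succ k) (Fin.succ kw) ∉ Ideal.span {chartGen xs (Fin.succ k) 0} :=
      ConeRung.strictExc_notMem_of_chartBase_eq z v k hq hvk e1 (v_notMem_span_z z v hx hd kw)
    haveI : NoZeroDivisors (chartRing xs (Fin.succ k) ⧸ Ideal.span {chartGen xs (Fin.succ k) 0}) :=
      IsDomain.to_noZeroDivisors _
    have hct : Ideal.Quotient.mk (Ideal.span {chartGen xs (Fin.succ k) 0})
        (chartBase xs (Fin.succ k) (xs (Fin.succ k))) ∈
        (chartRing xs (Fin.succ k) ⧸ Ideal.span {chartGen xs (Fin.succ k) 0})⁰ :=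
      mem_nonZeroDivisors_of_ne_zero (fun h => huc (Ideal.Quotient.eq_zero_iff_mem.mp h))
    have hca : Ideal.Quotient.mk (Ideal.span {chartGen xs (Fin.succ k) 0})
        (chartGen xs (Fin.succ k) (Fin.succ kw)) ∈
        (chartRing xs (Fin.succ k) ⧸ Ideal.span {chartGen xs (Fin.succ k) 0})⁰ :=
      mem_nonZeroDivisors_of_ne_zero (fun h => hac (Ideal.Quotient.eq_zero_iff_mem.mp h))
    exact depthFour_isRegular' (chartBase xs (Fin.succ k) (xs (Fin.succ k))) (chartGen xs (Fin.succ k) 0)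
      (chartGen xs (Fin.succ k) (Fin.succ kw)) hw3 h3 h2 hcD hct hca hc0 hρ'

include hx hd in
/-- **The tower is regular**: every blowing up of `Spec S` along `(I · Q₀) · 𝔪` is regular
(`I = (z² + w³) + 𝔪⁶` written with `𝔪`). [cite: StacksProject, Tag 080A] -/
theorem isRegular_of_isBlowup_member₆_mul_companion {Y : Scheme.{u}} {f : Y ⟶ Spec (.of S)}
    (hf : IsBlowup f (affineBlowup.idealSheaf ((II𝔪 * Q₀) * IsLocalRing.maximalIdeal S))) :
    Scheme.IsRegular Y := by
  rw [← hx] at hf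
  exact isRegular_of_isBlowup_mul_of_charts xs _ (isRegular_charts₆ z v hx hd kw) hf

include hx hd in
set_option maxRecDepth 8192 in
/-- **The depth-four member is in the companion class** (`I = (z² + w³) + 𝔪⁶`, companion
`Q₀ · 𝔪 ⊇ 𝔪¹⁰⁶`). [cite: StacksProject, Tag 080A] -/
theorem companion_member₆ :
    ∃ (Q : Ideal S) (m' : ℕ), IsLocalRing.maximalIdeal S ^ m' ≤ Q ∧
      ∃ (B : Scheme.{u}) (b : B ⟶ Spec (.of S)),
        IsBlowup b (affineBlowup.idealSheaf (II𝔪 * Q)) ∧ Scheme.IsRegular B := by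
  obtain ⟨B, b, hb⟩ := exists_isBlowup (Spec (.of S))
    (affineBlowup.idealSheaf ((II𝔪 * Q₀) * IsLocalRing.maximalIdeal S))
  refine ⟨Q₀ * IsLocalRing.maximalIdeal S, 106, ?_, B, b, by rwa [← mul_assoc],
    isRegular_of_isBlowup_member₆_mul_companion z v hx hd kw hb⟩
  rw [pow_succ]
  exact Ideal.mul_mono (by rw [← hx]; exact pow_le_Q₀₆ xs (Fin.succ kw) 0) le_rfl

include hx hd in
set_option maxRecDepth 8192 in
/-- **CORE RUNG (kernel beyond F6, the depth-four cusp member).** `S` regular local (any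
dimension): every blowing up `T` of `Spec S` along `I = (z² + w³) + 𝔪⁶` satisfies the conclusion
of the blow-up-form open core. [cite: StacksProject, Tag 080A] [cite: GortzWedhorn2020, Prop. 13.91 (2)] -/
theorem coreRung_member₆ (h𝔪 : IsLocalRing.maximalIdeal S ≠ ⊥) (T : Scheme.{u}) (f : T ⟶ Spec (.of S))
    (hf : IsBlowup f (affineBlowup.idealSheaf (II𝔪))) :
    ∃ (J : T.IdealSheafData) (T' : Scheme.{u}) (π : T' ⟶ T), J ≠ ⊥ ∧
      (∀ t : T, t ∈ J.support → f.base t = IsLocalRing.closedPoint S) ∧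
      IsBlowup π J ∧ Scheme.IsRegular T' := by
  rw [← hx] at hf
  have hI : II ≠ ⊥ := fun h =>
    span_sup_pow_maximalIdeal_ne_bot h𝔪 (Ideal.span {xs 0 ^ 2 + xs (Fin.succ kw) ^ 3}) 6
      (by rw [hx] at h; exact h)
  exact atomConclusion_of_pointBlowup_charts xs hx h𝔪 hI (N := 105)
    (by rw [← hx]; exact pow_le_Q₀₆ xs (Fin.succ kw) 0) (isRegular_charts₆ z v hx hd kw) T f hf

/-- **The registered core's binder shape (`stub_atomDimFourBlowup`), restricted to the depth-four
member** `I = (z² + w³) + 𝔪⁶` for a regular system of parameters `(z, v₁, …, v_m)`, `w = v_{kw}`;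
the dimension, characteristic, completeness, residue-field and off-fibre hypotheses are not used
(underscored). [cite: StacksProject, Tag 080A] -/
theorem atomDimFourBlowupAt_member₆ (p : ℕ) (_hp : p.Prime) (S : Type)
    [CommRing S] [IsRegularLocalRing S] [CharP S p]
    [IsAdicComplete (IsLocalRing.maximalIdeal S) S]
    [PerfectField (IsLocalRing.ResidueField S)] (_hS : ringKrullDim S = (4 : ℕ))
    {m : ℕ} (z : S) (v : Fin m → S)
    (hx : Ideal.span (Set.range (Fin.cons z v : Fin (m + 1) → S)) = IsLocalRing.maximalIdeal S)
    (hd : (IsLocalRing.maximalIdeal S).spanFinrank = m + 1) (kw : Fin m)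
    (h𝔪 : IsLocalRing.maximalIdeal S ≠ ⊥)
    (T : Scheme.{0}) (f : T ⟶ Spec (.of S))
    (hf : IsBlowup f (affineBlowup.idealSheaf
      (Ideal.span {(Fin.cons z v : Fin (m + 1) → S) 0 ^ 2 + (Fin.cons z v : Fin (m + 1) → S) (Fin.succ kw) ^ 3} ⊔
        IsLocalRing.maximalIdeal S ^ 6)))
    (_hoff : ∀ t : T, f.base t ≠ IsLocalRing.closedPoint S →
      IsRegularLocalRing (T.presheaf.stalk t)) :
    ∃ (J : T.IdealSheafData) (T' : Scheme.{0}) (π : T' ⟶ T), J ≠ ⊥ ∧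
      (∀ t : T, t ∈ J.support → f.base t = IsLocalRing.closedPoint S) ∧
      IsBlowup π J ∧ Scheme.IsRegular T' :=
  coreRung_member₆ z v hx hd kw h𝔪 T f hf

end LocalRung

end CuspDepthFour

end Summit.ResolutionOfSingularities.ResolutionOfSingularities.Theorems

end
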